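import Mathlib.Topology.Algebra.Group.Basic
import Mathlib.Tactic.Group
import HarnessLib

/-!
# Limits of conjugators: `c ∈ aᵢ · Tᵢ · aᵢ⁻¹ · Uᵢ` with `aᵢ → a`, `Uᵢ → 1` forces `a⁻¹ c a` into the
# limit of the `Tᵢ` ([SemiAnbd] Thm 5.4 (i) p. 66 / Comments (6)(b): "converge in the profinite topology")

Mochizuki, *Semi-graphs of anabelioids*, Publ. RIMS **42** (2006), §5, Thm. 5.4 (i) p. 66 with the proof
of Thm. 3.7 (iii) p. 41 and the author's Comments (6)(b) ("the various conjugates … converge in the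
profinite topology … [cf. Remark 2.2.1]") [cite: MochizukiSemiAnbd2006, Thm 5.4 (i), p. 66].

PROOF-ONLY, pure topological group theory, Mathlib-only imports (cell row T54-B, producer of the
compact/image-form branch-pair dictionary (AI4″) `ArithLevelDataCpt.stabBranchPairAug`, holder
abc-iut-w4-d059, second abc-iut-w4-d085 = this file; `HOME/plan/GAP-LEDGER.md` G-w4d053-1).  The LAST
STEP of the (AI4″) production pushes level-wise containments
`aug(c) = aug(yᵢ) · aug(kᵢ) · aug(yᵢ)⁻¹ · aug(lᵢ)` (`kᵢ` in a branch-pair group, `lᵢ` in the `i`-th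
level kernel) to the COMPACT quotient `Π_A`, where the conjugators `aug(yᵢ)` acquire a limit `a` along an
ultrafilter and the level-kernel images `aug(lᵢ)` tend to `1` (arithmetic cofinality of the tower).  This
file isolates the elementary limit statement, in a general Hausdorff-free form over any filter:

* `tendsto_of_eq_conj_mul` — if `c = aᵢ tᵢ aᵢ⁻¹ uᵢ` eventually, `aᵢ → a`, `uᵢ → 1`, then `tᵢ → a⁻¹ c a`
  (the `tᵢ` are FORCED to converge; no compactness is needed for them);
* `conj_mem_closure_of_eq_conj_mul` — hence `a⁻¹ c a ∈ closure (t '' s)` for every `s` in the filter;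
* `conj_mem_of_eq_conj_mul` / `subset_conj_image_of_forall_eq_conj_mul` — hence `a⁻¹ c a` lies in any
  set `T∞` containing the limits of eventual selections of the `Tᵢ`, i.e. `S ⊆ a · T∞ · a⁻¹` for a set
  `S` all of whose elements admit such level-wise factorisations.

No completion of the arithmetic group and no continuous extension of `aug` is needed on this route.
Nothing here refers to the IUT corpus; no side is taken on [IUTchIII] Cor 3.12; typed ≠ proved.
-/

namespace Literature.AnabelianGeometry.SemiGraphs

open Filter Topology

universe u w

section ConjugateLimit

variable {G : Type u} [Group G] [TopologicalSpace G] [IsTopologicalGroup G]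
variable {ι : Type w} {l : Filter ι} {a : ι → G} {a₀ : G} {u t : ι → G} {c : G}

/-- **Forced convergence of the middle factor**: if `c = aᵢ · tᵢ · aᵢ⁻¹ · uᵢ` eventually along `l`,
`aᵢ → a₀` and `uᵢ → 1`, then `tᵢ → a₀⁻¹ · c · a₀`. [cite: MochizukiSemiAnbd2006, Thm 5.4 (i), p. 66] -/
theorem tendsto_of_eq_conj_mul (ha : Tendsto a l (𝓝 a₀)) (hu : Tendsto u l (𝓝 1))
    (hc : ∀ᶠ i in l, c = a i * t i * (a i)⁻¹ * u i) :
    Tendsto t l (𝓝 (a₀⁻¹ * c * a₀)) := by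
  -- solve for `tᵢ`: `tᵢ = aᵢ⁻¹ · c · uᵢ⁻¹ · aᵢ`
  have ht : ∀ᶠ i in l, (a i)⁻¹ * c * (u i)⁻¹ * a i = t i := by
    filter_upwards [hc] with i hi
    rw [hi]
    group
  have hlim : Tendsto (fun i => (a i)⁻¹ * c * (u i)⁻¹ * a i) l (𝓝 (a₀⁻¹ * c * 1⁻¹ * a₀)) :=
    ((ha.inv.mul tendsto_const_nhds).mul hu.inv).mul ha
  rw [inv_one, mul_one] at hlim
  exact hlim.congr' ht

/-- **The conjugated element lies in the closure of every tail of the middle factors**: under the same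
hypotheses (and `l ≠ ⊥`), `a₀⁻¹ · c · a₀ ∈ closure (t '' s)` for every `s ∈ l`.
[cite: MochizukiSemiAnbd2006, Thm 5.4 (i), p. 66] -/
theorem conj_mem_closure_of_eq_conj_mul [l.NeBot] (ha : Tendsto a l (𝓝 a₀)) (hu : Tendsto u l (𝓝 1))
    (hc : ∀ᶠ i in l, c = a i * t i * (a i)⁻¹ * u i) {s : Set ι} (hs : s ∈ l) :
    a₀⁻¹ * c * a₀ ∈ closure (t '' s) :=
  mem_closure_of_tendsto (tendsto_of_eq_conj_mul ha hu hc)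
    (mem_of_superset hs fun _ hi => Set.mem_image_of_mem t hi)

/-- **Containment in a limit set**: if moreover `T∞` contains every limit along `l` of the selection `t`
(the caller identifies the limits — e.g. inside the image of a compact branch-pair group), then
`a₀⁻¹ · c · a₀ ∈ T∞`, i.e. `c ∈ a₀ · T∞ · a₀⁻¹`. [cite: MochizukiSemiAnbd2006, Thm 5.4 (i), p. 66] -/
theorem conj_mem_of_eq_conj_mul (ha : Tendsto a l (𝓝 a₀)) (hu : Tendsto u l (𝓝 1))
    (hc : ∀ᶠ i in l, c = a i * t i * (a i)⁻¹ * u i) {Tlim : Set G}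
    (hT : ∀ x : G, Tendsto t l (𝓝 x) → x ∈ Tlim) :
    c ∈ (fun x => a₀ * x * a₀⁻¹) '' Tlim :=
  ⟨a₀⁻¹ * c * a₀, hT _ (tendsto_of_eq_conj_mul ha hu hc), by
    show a₀ * (a₀⁻¹ * c * a₀) * a₀⁻¹ = c
    group⟩

/-- **Set form** (the last step of the (AI4″) production, in `Π_A`): let `aᵢ → a₀` and let the "error
sets" `Uᵢ` shrink to `1` along `l` (`∀ V ∈ 𝓝 1, ∀ᶠ i, Uᵢ ⊆ V` — the images of the level kernels of an
arithmetically cofinal tower).  If every `c ∈ S` factors eventually as `c = aᵢ · tᵢ · aᵢ⁻¹ · uᵢ` with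
`tᵢ ∈ Tᵢ`, `uᵢ ∈ Uᵢ`, and `T∞` contains all limits along `l` of eventual selections of the `Tᵢ`, then
`S ⊆ a₀ · T∞ · a₀⁻¹`.  [NB: `l` must not be `⊥` for `T∞` to be constrained; along an ultrafilter on the
levels every selection inside a compact set converges, which is how the caller produces `a₀`.]
[cite: MochizukiSemiAnbd2006, Thm 5.4 (i), p. 66] -/
theorem subset_conj_image_of_forall_eq_conj_mul (ha : Tendsto a l (𝓝 a₀)) (S : Set G)
    (T U : ι → Set G) (hU : ∀ V ∈ 𝓝 (1 : G), ∀ᶠ i in l, U i ⊆ V)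
    (hS : ∀ c ∈ S, ∃ t u : ι → G, (∀ᶠ i in l, t i ∈ T i) ∧ (∀ᶠ i in l, u i ∈ U i) ∧
      ∀ᶠ i in l, c = a i * t i * (a i)⁻¹ * u i)
    (Tlim : Set G) (hT : ∀ t : ι → G, (∀ᶠ i in l, t i ∈ T i) → ∀ x : G, Tendsto t l (𝓝 x) → x ∈ Tlim) :
    S ⊆ (fun x => a₀ * x * a₀⁻¹) '' Tlim := by
  intro c hc
  obtain ⟨t, u, htT, huU, hfac⟩ := hS c hc
  -- the error factors tend to `1`
  have hu : Tendsto u l (𝓝 1) := by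
    rw [tendsto_iff_forall_eventually_mem]
    intro V hV
    filter_upwards [hU V hV, huU] with i hUV hi using hUV hi
  exact conj_mem_of_eq_conj_mul ha hu hfac (hT t htT)

end ConjugateLimit

end Literature.AnabelianGeometry.SemiGraphs
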